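import Literature.Computability.Complexity.UniversalStep
import Literature.Computability.Complexity.OrbitDeciders
import HarnessLib

/-!
# The bounded-halting language `SPACETMSAT` of the universal step, I: the language and its `PSPACE` decider

Arora–Barak 2009, §4.2, eq. (4.3): "`SPACE TMSAT = {⟨M, w, 1ⁿ⟩ : DTM M accepts w in space n}` …
can be easily shown to be PSPACE-complete (Exercise 4.2)"; Homer–Selman 2011, §7.5.1:
`𝒰_PS = {⟨i, x, 0^l⟩ | PSᵢ accepts x in space ≤ l}` is `≤ᵖₘ`-complete for `PSPACE` (Homework
7.13). Over the tree's machine model the role of "DTM `M`" is played by a FLAT PROGRAM `P`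
(`FlatPrograms.lean`: the table-free normal form every `Turing.FinTM2` compiles to) run by the
UNIVERSAL STEP `UnivStep.ustepFn ∈ FP` on string codes `z = ⟨P, ⟨pc, stacks⟩⟩`
(`UniversalStep.lean`), and the generic space-bounded simulation is the following guarded orbit:

* an instance is a record `w = ⟨P, ⟨cfg, ⟨u, ⟨k, acc⟩⟩⟩⟩`: a program, an initial configuration, a
  unary SPACE BUDGET `u`, the (binary) index `k` of the output stack and the target code `acc`
  of an accepting output stack;
* the state `mkT a u k acc z` carries the answer bit `a` and the current code `z`; one round
  (`SpaceTMSAT.F`) replaces `z` by `ustepFn z` if `|z| ≤ |u|` and FREEZES it otherwise (the space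
  guard), and recomputes `a = [z halted] ∧ [stack k of z = acc]`;
* `SPACETMSAT` is the set of instances whose answer bit is set after `2^{2|u|+1}` rounds — more
  rounds than there are codes within the budget, so that a computation staying within the budget
  has halted by then or never will (this pigeonhole is used in part II);
* `SpaceTMSAT.decider : OrbitDecider SPACETMSAT` and **`SPACETMSAT_mem_PSPACE`**
  (`OrbitDecider.mem_PSPACE`, i.e. the loop machine of `SpaceLoop.lean`): the generic
  polynomial-space algorithm "simulate, reusing the space, and cut off after exponentially many
  steps" (Arora–Barak 2009, Thm. 4.2 `SPACE(s) ⊆ DTIME(2^{O(s)})`, Rem. 4.3: "keeps a counter and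
  halts if the computation runs for more than `2^{cS(n)}` steps").

Part II (`SpaceTMSATHard.lean`) proves `PSPACE`-hardness — every `L ∈ PSPACE` Karp-reduces to
`SPACETMSAT` by `x ↦ ⟨compiled decider of L, its initial configuration on x, its space bound, …⟩` —
and discharges the named fact `exists_isComplete_PSPACE` of `SpaceOracles.lean`.

Design note: `SPACETMSAT` is DEFINED by the decider's verdict (so `decider.correct` is
definitional); that this verdict is "`P` halts from `cfg` within space `|u|` with stack `k`
reading `acc`" for the instances that matter is the content of part II
(`SpaceTMSAT.iterate_F_mkT`, the simulation lemmas of `UniversalStep.lean`). Malformed instances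
get whatever verdict the guarded orbit produces — irrelevant for completeness, as for every
concrete complete language.

## References

* S. Arora, B. Barak, *Computational Complexity: A Modern Approach*, CUP 2009, §4.2 (Def. 4.9,
  eq. (4.3) `SPACE TMSAT`, Exercise 4.2), Thm. 4.2 and Rem. 4.3 (the step counter), §4.1
  [AroraBarakCC2009].
* S. Homer, A. L. Selman, *Computability and Complexity Theory*, 2nd ed., Springer 2011, §7.5.1
  (`𝒰_PS`, Homework 7.13; Prop. 7.7) [HomerSelman2011].
-/

noncomputable section

namespace Literature.Computability.Complexity

open _root_.Computability Polynomial Brick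

namespace SpaceTMSAT

open UnivStep

/-! ### States and their accessors -/

/-- The state `a ⟨u, ⟨k, ⟨acc, z⟩⟩⟩`: answer bit, space budget, output-stack index, accepting code,
current code `z = ⟨P, ⟨pc, stacks⟩⟩`. [cite: AroraBarakCC2009, §4.2 eq. (4.3) and Rem. 4.3] -/
def mkT (a : Bool) (u k acc z : List Bool) : List Bool :=
  a :: boolPair u (boolPair k (boolPair acc z))

/-- Length of a state. [folklore] -/
theorem length_mkT (a : Bool) (u k acc z : List Bool) :
    (mkT a u k acc z).length = 2 * u.length + 2 * k.length + 2 * acc.length + z.length + 7 := by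
  simp only [mkT, length_boolPair, List.length_cons]
  ring

/-- The head symbol of a state is its answer bit. [folklore] -/
@[simp] theorem headI_mkT (a : Bool) (u k acc z : List Bool) : (mkT a u k acc z).headI = a := rfl

/-- Accessor: the budget. [folklore] -/
def uT : List Bool → List Bool := fstF ∘ List.tail
/-- Accessor: the output-stack index. [folklore] -/
def kT : List Bool → List Bool := nthF 1 ∘ List.tail
/-- Accessor: the accepting code. [folklore] -/
def accT : List Bool → List Bool := nthF 2 ∘ List.tail
/-- Accessor: the current code. [folklore] -/
def zT : List Bool → List Bool := sndPow 2 ∘ List.tail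

/-- `uT` on a state. [folklore] -/
@[simp] theorem uT_mkT (a : Bool) (u k acc z : List Bool) : uT (mkT a u k acc z) = u := by simp [uT, mkT]
/-- `kT` on a state. [folklore] -/
@[simp] theorem kT_mkT (a : Bool) (u k acc z : List Bool) : kT (mkT a u k acc z) = k := by simp [kT, mkT]
/-- `accT` on a state. [folklore] -/
@[simp] theorem accT_mkT (a : Bool) (u k acc z : List Bool) : accT (mkT a u k acc z) = acc := by
  simp [accT, mkT]
/-- `zT` on a state. [folklore] -/
@[simp] theorem zT_mkT (a : Bool) (u k acc z : List Bool) : zT (mkT a u k acc z) = z := by simp [zT, mkT]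

/-- `uT ∈ FP`. [folklore] -/
theorem uT_mem_FP : uT ∈ FP := comp_mem_FP fstF_mem_FP PRelSigma.tail_mem_FP
/-- `kT ∈ FP`. [folklore] -/
theorem kT_mem_FP : kT ∈ FP := comp_mem_FP (nthF_mem_FP 1) PRelSigma.tail_mem_FP
/-- `accT ∈ FP`. [folklore] -/
theorem accT_mem_FP : accT ∈ FP := comp_mem_FP (nthF_mem_FP 2) PRelSigma.tail_mem_FP
/-- `zT ∈ FP`. [folklore] -/
theorem zT_mem_FP : zT ∈ FP := comp_mem_FP (sndPow_mem_FP 2) PRelSigma.tail_mem_FP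

/-! ### The guarded universal step -/

/-- **The space guard**: step the code only while it fits the budget, `|z| ≤ |u|`; otherwise
freeze it. [cite: AroraBarakCC2009, §4.2 eq. (4.3) ("accepts w in space n")] -/
def gstep (u z : List Bool) : List Bool :=
  if z.length ≤ u.length then ustepFn z else z

/-- The guard as a one-bit string function: `[|z| ≤ |u|]`. [folklore] -/
def guardC : List Bool → List Bool := lenLeFn X ∘ fanoutFn uT zT

/-- The new code. [folklore] -/
def zNew : List Bool → List Bool := iteFn guardC (ustepFn ∘ zT) zT

/-- `zNew` on a state is the guarded step. [folklore] -/
theorem zNew_mkT (a : Bool) (u k acc z : List Bool) : zNew (mkT a u k acc z) = gstep u z := by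
  have hg : guardC (mkT a u k acc z) = [decide (z.length ≤ u.length)] := by
    simp [guardC, lenLeFn_boolPair]
  unfold zNew gstep
  by_cases h : z.length ≤ u.length
  · rw [iteFn_apply_true (by rw [hg, decide_eq_true h]), if_pos h, Function.comp_apply, zT_mkT]
  · rw [iteFn_apply_false (by rw [hg, decide_eq_false h]), if_neg h, zT_mkT]

/-- `zNew ∈ FP`. [cite: AroraBarakCC2009, §1.3 (closure under composition)] -/
theorem zNew_mem_FP : zNew ∈ FP :=
  iteFn_mem_FP (comp_mem_FP (lenLeFn_mem_FP X) (fanoutFn_mem_FP uT_mem_FP zT_mem_FP))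
    (comp_mem_FP ustepFn_mem_FP zT_mem_FP) zT_mem_FP

/-! ### The answer bit -/

/-- The code of the stack with (binary) index `k` of a code `z = ⟨P, ⟨pc, stacks⟩⟩`. [folklore] -/
def outOf (k z : List Bool) : List Bool := nthLF (boolPair (ssF z) (boolPair k (ssF z)))

/-- **The answer bit** of a code: halted (no instruction fetched) and the output stack reads `acc`.
[cite: AroraBarakCC2009, §4.2 eq. (4.3) ("M accepts w")] -/
def accBit (k acc z : List Bool) : Bool :=
  decide (insF z = []) && decide (outOf k z = acc)

/-- The halting test on the new code. [folklore] -/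
def haltC : List Bool → List Bool := isNilFn ∘ insF ∘ zNew
/-- The output test on the new code. [folklore] -/
def outC : List Bool → List Bool :=
  eqPairFn ∘ fanoutFn (nthLF ∘ fanoutFn (ssF ∘ zNew) (fanoutFn kT (ssF ∘ zNew))) accT
/-- The new answer bit. [folklore] -/
def aNew : List Bool → List Bool := andFn haltC outC

/-- `aNew` on a state. [folklore] -/
theorem aNew_mkT (a : Bool) (u k acc z : List Bool) :
    aNew (mkT a u k acc z) = [accBit k acc (gstep u z)] := by
  have h1 : haltC (mkT a u k acc z) = [decide (insF (gstep u z) = [])] := by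
    simp [haltC, zNew_mkT, isNilFn]
  have h2 : outC (mkT a u k acc z) = [decide (outOf k (gstep u z) = acc)] := by
    simp [outC, zNew_mkT, eqPairFn_boolPair, outOf]
  rw [aNew, andFn_apply h1 h2, accBit]

/-- `aNew ∈ FP`. [cite: AroraBarakCC2009, §1.3] -/
theorem aNew_mem_FP : aNew ∈ FP :=
  andFn_mem_FP (comp_mem_FP isNilFn_mem_FP (comp_mem_FP insF_mem_FP zNew_mem_FP))
    (comp_mem_FP eqPairFn_mem_FP (fanoutFn_mem_FP
      (comp_mem_FP nthLF_mem_FP (fanoutFn_mem_FP (comp_mem_FP ssF_mem_FP zNew_mem_FP)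
        (fanoutFn_mem_FP kT_mem_FP (comp_mem_FP ssF_mem_FP zNew_mem_FP))))
      accT_mem_FP))

/-! ### The round function, the instances, the language -/

/-- **One round**: `a ⟨u, k, acc, z⟩ ↦ a' ⟨u, k, acc, z'⟩` with `z'` the guarded step of `z` and
`a'` its answer bit. [cite: AroraBarakCC2009, §4.2 eq. (4.3) and Rem. 4.3] -/
def F : List Bool → List Bool := fun w =>
  aNew w ++ fanoutFn uT (fanoutFn kT (fanoutFn accT zNew)) w

/-- The round on a state. [folklore] -/
theorem F_mkT (a : Bool) (u k acc z : List Bool) :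
    F (mkT a u k acc z) = mkT (accBit k acc (gstep u z)) u k acc (gstep u z) := by
  rw [F, aNew_mkT]
  simp only [fanoutFn_apply, uT_mkT, kT_mkT, accT_mkT, zNew_mkT]
  rfl

/-- `F ∈ FP`. [cite: AroraBarakCC2009, §1.3] -/
theorem F_mem_FP : F ∈ FP :=
  append_mem_FP aNew_mem_FP
    (fanoutFn_mem_FP uT_mem_FP (fanoutFn_mem_FP kT_mem_FP (fanoutFn_mem_FP accT_mem_FP zNew_mem_FP)))

/-- Instance field: the budget `u` of `w = ⟨P, ⟨cfg, ⟨u, ⟨k, acc⟩⟩⟩⟩`. [folklore] -/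
def uW : List Bool → List Bool := nthF 2
/-- Instance field: the output-stack index. [folklore] -/
def kW : List Bool → List Bool := nthF 3
/-- Instance field: the accepting code. [folklore] -/
def accW : List Bool → List Bool := sndPow 3
/-- Instance field: the initial code `⟨P, cfg⟩`. [folklore] -/
def z0W : List Bool → List Bool := fanoutFn (nthF 0) (nthF 1)

/-- The pre-initial state `0 ⟨u, k, acc, ⟨P, cfg⟩⟩` of an instance. [folklore] -/
def preT : List Bool → List Bool :=
  List.cons false ∘ fanoutFn uW (fanoutFn kW (fanoutFn accW z0W))

/-- `preT` on an instance. [folklore] -/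
theorem preT_apply (w : List Bool) : preT w = mkT false (uW w) (kW w) (accW w) (z0W w) := by
  simp only [preT, Function.comp_apply, fanoutFn_apply, mkT]

/-- `preT` on a well-formed instance. [folklore] -/
theorem preT_record (P cfg u k acc : List Bool) :
    preT (boolPair P (boolPair cfg (boolPair u (boolPair k acc)))) = mkT false u k acc (boolPair P cfg) := by
  rw [preT_apply]
  simp [uW, kW, accW, z0W]

/-- **The initial state**: one round applied to the pre-initial state (which fills in the answer
bit). [folklore] -/
def ι : List Bool → List Bool := F ∘ preT

/-- **The budget exponent**: `1 u u`, of length `2|u| + 1` — the orbit is read after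
`2^{2|u|+1} > (|u| + 1) · 2^{|u|} ≥ #{codes of length ≤ |u|}` rounds.
[cite: AroraBarakCC2009, Thm. 4.2 and Rem. 4.3 (cut-off after 2^{cS(n)} steps)] -/
def Nu : List Bool → List Bool := fun w => true :: (uW w ++ uW w)

/-- `preT ∈ FP`. [cite: AroraBarakCC2009, §1.3] -/
theorem preT_mem_FP : preT ∈ FP :=
  comp_mem_FP (cons_mem_FP false) (fanoutFn_mem_FP (nthF_mem_FP 2) (fanoutFn_mem_FP (nthF_mem_FP 3)
    (fanoutFn_mem_FP (sndPow_mem_FP 3) (fanoutFn_mem_FP (nthF_mem_FP 0) (nthF_mem_FP 1)))))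
/-- `ι ∈ FP`. [cite: AroraBarakCC2009, §1.3] -/
theorem ι_mem_FP : ι ∈ FP := comp_mem_FP F_mem_FP preT_mem_FP
/-- `Nu ∈ FP`. [cite: AroraBarakCC2009, §1.3] -/
theorem Nu_mem_FP : Nu ∈ FP :=
  comp_mem_FP (cons_mem_FP true) (append_mem_FP (nthF_mem_FP 2) (nthF_mem_FP 2))

/-- Length of the budget exponent. [folklore] -/
@[simp] theorem length_Nu (w : List Bool) : (Nu w).length = 2 * (uW w).length + 1 := by
  simp [Nu]; ring

end SpaceTMSAT

/-- **`SPACETMSAT`, the bounded-halting language of the universal step**: the instances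
`⟨P, ⟨cfg, ⟨u, ⟨k, acc⟩⟩⟩⟩` — flat program, initial configuration, unary space budget, output
stack, accepting output — on which the guarded universal simulation (`SpaceTMSAT.F`: step while
the code fits the budget, freeze otherwise) shows, after `2^{2|u|+1}` rounds, a halted code whose
output stack reads `acc`. For the compiled decider of a `PSPACE` language started on its initial
configuration with its space bound as budget this is acceptance (part II), which makes the
language `PSPACE`-complete; here: it is in `PSPACE`.
[cite: AroraBarakCC2009, §4.2, eq. (4.3) (SPACE TMSAT) and Exercise 4.2] [cite: HomerSelman2011, §7.5.1 (𝒰_PS, Homework 7.13)] -/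
def SPACETMSAT : Language Bool :=
  {w | (SpaceTMSAT.F^[2 ^ (SpaceTMSAT.Nu w).length] (SpaceTMSAT.ι w)).headI = true}

namespace SpaceTMSAT

open UnivStep

/-! ### The orbit: shape and size -/

/-- An output bound of the universal step. [folklore] -/
theorem exists_ustep_bound : ∃ q : Polynomial ℕ, ∀ z, (ustepFn z).length ≤ q.eval z.length :=
  OrbitDecider.exists_poly_length_le ustepFn_mem_FP

/-- The chosen output bound `qU` of the universal step. [folklore] -/
def qU : Polynomial ℕ := Classical.choose exists_ustep_bound

/-- `|ustepFn z| ≤ qU(|z|)`. [folklore] -/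
theorem length_ustepFn_le (z : List Bool) : (ustepFn z).length ≤ qU.eval z.length :=
  Classical.choose_spec exists_ustep_bound z

/-- The guarded step keeps the code within `max |z| qU(|u|)`. [folklore] -/
theorem length_gstep_le (u z : List Bool) {B : ℕ} (hz : z.length ≤ B) (hB : qU.eval u.length ≤ B) :
    (gstep u z).length ≤ B := by
  unfold gstep
  split_ifs with h
  · exact (length_ustepFn_le z).trans ((TM2Iter.eval_mono qU h).trans hB)
  · exact hz

/-- **Shape of the orbit**: every iterate of `F` on a state is a state with the same `u, k, acc`
and a code bounded by any `B ≥ |z|, qU(|u|)`. [folklore] -/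
theorem iterate_F_shape (a : Bool) (u k acc z : List Bool) {B : ℕ} (hz : z.length ≤ B)
    (hB : qU.eval u.length ≤ B) (m : ℕ) :
    ∃ a' z', F^[m] (mkT a u k acc z) = mkT a' u k acc z' ∧ z'.length ≤ B := by
  induction m with
  | zero => exact ⟨a, z, rfl, hz⟩
  | succ m ih =>
    obtain ⟨a', z', h, hz'⟩ := ih
    exact ⟨_, _, by rw [Function.iterate_succ_apply', h, F_mkT], length_gstep_le u z' hz' hB⟩

/-- Field lengths of an instance. [folklore] -/
theorem length_fields_le (w : List Bool) :
    (uW w).length ≤ w.length ∧ (kW w).length ≤ w.length ∧ (accW w).length ≤ w.length ∧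
      (z0W w).length ≤ 3 * w.length + 2 := by
  refine ⟨length_nthF_le 2 w, length_nthF_le 3 w, length_sndPow_le 3 w, ?_⟩
  rw [z0W, fanoutFn_apply, length_boolPair]
  have h0 := length_nthF_le 0 w
  have h1 := length_nthF_le 1 w
  omega

/-- **The space polynomial** of the decider. [folklore] -/
def sT : Polynomial ℕ := 9 * X + qU + 9

/-- **Size of the orbit**: every state of the orbit of an instance `w` has length `≤ sT(|w|)`.
[cite: AroraBarakCC2009, Thm. 4.2 (space-bounded simulation)] -/
theorem length_iterate_F_ι_le (w : List Bool) (m : ℕ) : (F^[m] (ι w)).length ≤ sT.eval w.length := by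
  obtain ⟨hu, hk, hacc, hz0⟩ := length_fields_le w
  have hB : qU.eval (uW w).length ≤ 3 * w.length + 2 + qU.eval w.length :=
    (TM2Iter.eval_mono qU hu).trans (Nat.le_add_left _ _)
  obtain ⟨a', z', h, hz'⟩ := iterate_F_shape false (uW w) (kW w) (accW w) (z0W w)
    (B := 3 * w.length + 2 + qU.eval w.length) (by omega) hB (m + 1)
  rw [ι, Function.comp_apply, preT_apply, ← Function.iterate_succ_apply, h, length_mkT, sT]
  simp only [eval_add, eval_mul, eval_ofNat, eval_X]
  omega

/-- **The `PSPACE` decider of `SPACETMSAT`** as an orbit decider: round function `F`, initial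
state `ι`, budget exponent `Nu`, space polynomial `sT`; correctness is the definition of the
language. [cite: AroraBarakCC2009, §4.2 (SPACE TMSAT ∈ PSPACE, Exercise 4.2) and Thm. 4.2 / Rem. 4.3] -/
def decider : OrbitDecider SPACETMSAT where
  F := F
  F_mem := F_mem_FP
  ι := ι
  ι_mem := ι_mem_FP
  Nu := Nu
  Nu_mem := Nu_mem_FP
  s := sT
  Nu_le w := by
    rw [length_Nu, sT]
    have := (length_fields_le w).1
    simp only [eval_add, eval_mul, eval_ofNat, eval_X]
    omega
  size_le := length_iterate_F_ι_le
  correct _ := Iff.rfl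

/-! ### The orbit of a small computation (interface for part II) -/

/-- **A computation within the budget is simulated exactly.** If all iterates `ustepFn^[m] z₀`
have length `≤ |u|`, the orbit of `mkT a u k acc z₀` under `F` is
`m ↦ mkT aₘ u k acc (ustepFn^[m] z₀)` with `aₘ` the answer bit of the `m`-th code (`m ≥ 1`).
[cite: AroraBarakCC2009, §4.2 eq. (4.3)] -/
theorem iterate_F_mkT (a : Bool) (u k acc z₀ : List Bool)
    (hsmall : ∀ m, (ustepFn^[m] z₀).length ≤ u.length) (m : ℕ) :
    F^[m + 1] (mkT a u k acc z₀) =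
      mkT (accBit k acc (ustepFn^[m + 1] z₀)) u k acc (ustepFn^[m + 1] z₀) := by
  induction m with
  | zero =>
    rw [Function.iterate_one, F_mkT, gstep, if_pos (by simpa using hsmall 0), Function.iterate_one]
  | succ m ih =>
    rw [Function.iterate_succ_apply', ih, F_mkT, gstep, if_pos (hsmall (m + 1)),
      ← Function.iterate_succ_apply' ustepFn (m + 1)]

/-- The verdict on a well-formed instance whose computation stays within the budget: the answer
bit of the code after `2^{2|u|+1} + 1` universal steps. [cite: AroraBarakCC2009, §4.2 eq. (4.3)] -/
theorem mem_SPACETMSAT_iff (P cfg u k acc : List Bool)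
    (hsmall : ∀ m, (ustepFn^[m] (boolPair P cfg)).length ≤ u.length) :
    boolPair P (boolPair cfg (boolPair u (boolPair k acc))) ∈ SPACETMSAT ↔
      accBit k acc (ustepFn^[2 ^ (2 * u.length + 1) + 1] (boolPair P cfg)) = true := by
  show (F^[2 ^ (Nu _).length] (ι _)).headI = true ↔ _
  have hu : uW (boolPair P (boolPair cfg (boolPair u (boolPair k acc)))) = u := by simp [uW]
  rw [length_Nu, hu, ι, Function.comp_apply, preT_record, ← Function.iterate_succ_apply,
    iterate_F_mkT false u k acc _ hsmall, headI_mkT]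

end SpaceTMSAT

/-- **`SPACETMSAT ∈ PSPACE`.** [cite: AroraBarakCC2009, §4.2 (Exercise 4.2) and Thm. 4.2] -/
theorem SPACETMSAT_mem_PSPACE : SPACETMSAT ∈ PSPACE :=
  SpaceTMSAT.decider.mem_PSPACE

end Literature.Computability.Complexity
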